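import Summits.QuantumFields.YangMills.Theorems.ColdStartUniversalityLatticeLangevinLezaudBernstein
import Summits.QuantumFields.YangMills.Theorems.ColdStartUniversalityLatticeLangevinPlaquetteVariance
import HarnessLib

/-!
# Route `ColdStartUniversality` (fixed-cut-off SZZ dynamics, sampler statistics): ★★★ VOLUME-ASSISTED BERNSTEIN INEQUALITY FOR THE RUNNING
# TIME-AVERAGE OF THE MEAN PLAQUETTE after the `O(log L)` burn-in, `|β'| < 1/12` — self-averaging (`Var = O(1/L³)`) enters the rate

Helper file (seat `ym-line-csu-p1`, g37; `--supports stmt-QuantumFields-24809`).  SU(2) lattice Langevin dynamics of Shen–Zhu–Zhu at `(L, β')`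
with `|β'| < 1/12` (`λ = 1 − 12|β'|`), Wilson measure `μ = μ_{β'}`, action density `s̄ = S_W/#𝒫 ∈ [0, 4]` (`#𝒫 = 3L³`), burn-in
`a = 2 + t₀ + u` with `log B ≤ 2λt₀`.  Lezaud's Bernstein inequality (`…LezaudBernstein`, variance-sensitive, volume-free) combined with the
volume-uniform Gibbs variance bound `Var_{μ_{β'}}(s̄) ≤ 32/(λ·#𝒫)` (g25, `wilson_actionDensity_variance_uniform`, Shen–Zhu–Zhu Cor. 4.4) gives

* ★★★ `coldStart_actionDensity_timeAverage_deviation_le_uniform` — for EVERY strong solution from a deterministic start, every `T > 0`, `r > 0`: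
  `P[ |T⁻¹ ∫_{(0,T]} s̄(U_{2+t₀+u+s}) ds − ⟨s̄⟩_{μ_{β'}}| ≥ r ] ≤ 2e · exp(−λ·T·r² / (128/(λ·#𝒫) + 8r))`.

Reading: in the Gaussian regime `r ≲ 16/(λ#𝒫)` the rate is `λ²·#𝒫·T·r²/256` — the running time-average of a SELF-AVERAGING observable
concentrates `#𝒫 = 3L³` times faster than a generic bounded one; for `r ≥ 16/(λ#𝒫)` the bound is `≤ 2e·exp(−λTr/16)`.  Neither constant
depends on `L` otherwise; the price is the burn-in `2 + t₀ = O(log L)`.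
[cite: Lezaud2001, Theorem 1.1 and Remark 1.2] [cite: ShenZhuZhu2022, Corollary 4.4].  THEOREMS ONLY, no definition, no sorry.  HONEST FRAMING:
RECORD-rung R3 plumbing at FIXED cut-off in LATTICE units, high-temperature window `|β'| < 1/12` only; the route's scaling `β'_K → ∞` leaves the
window; `UniformColdStartMixing` (24809) is NOT restated; nothing K-uniform is proved; no crux, rung or summit statement is proved; the
Yang–Mills mass gap is NOT proved.
-/

set_option autoImplicit false

noncomputable section

namespace Summit.QuantumFields.YangMills.Theorems.ColdStartUniversality

open MeasureTheory ProbabilityTheory Filter Set Topology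
open scoped BigOperators NNReal ENNReal
open Literature.Probability.Process Literature.MathematicalPhysics.QuantumFieldTheory
open Literature.MathematicalPhysics.QuantumLattice (fundamentalRep fundamentalLatticeRep continuous_fundamentalRep)

variable {L : ℕ} [NeZero L]

/-- ★★★ **VOLUME-ASSISTED BERNSTEIN INEQUALITY FOR THE RUNNING TIME-AVERAGE OF THE MEAN PLAQUETTE, `|β'| < 1/12`.**  For every `L`,
`|β'| < 1/12` (`λ := 1 − 12|β'|`), every deterministic start `z`, EVERY strong solution `U` from `z` on ANY filtered probability space, all
`t₀, u` with `log B ≤ 2λt₀` (`B = 96|β'|#E + 10|β'|#𝒫 + log 2 + #E·log(3/2)`), every `T > 0` and `r > 0`: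

  `P[ |T⁻¹ ∫_{(0,T]} S_W(U_{2+t₀+u+s})/#𝒫 ds − ∫ S_W/#𝒫 dμ_{β'}| ≥ r ] ≤ 2e · exp(−λ·T·r² / (128/(λ·#𝒫) + 8r))`

(Lezaud's Bernstein inequality `coldStart_timeAverage_tail_le_bernstein_uniform` for `±S_W/#𝒫` with `b = 4` and the volume-uniform variance
`σ² = 32/(λ#𝒫)` of `wilson_actionDensity_variance_uniform`). [cite: Lezaud2001, Theorem 1.1 and Remark 1.2] [cite: ShenZhuZhu2022, Corollary 4.4] -/
theorem coldStart_actionDensity_timeAverage_deviation_le_uniform (L : ℕ) [NeZero L] (β' : ℝ) (hβ : |β'| < 1 / 12)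
    (z : GaugeConfig 3 L (Matrix.specialUnitaryGroup (Fin 2) ℂ))
    {Ω : Type} [MeasurableSpace Ω] {P : Measure Ω} [IsProbabilityMeasure P]
    {W : ℝ≥0 → Ω → (Edge 3 L × NoiseIdx 2 → ℝ)} (hW : IsFlatBrownian W P)
    {U : ℝ≥0 → Ω → GaugeConfig 3 L (Matrix.specialUnitaryGroup (Fin 2) ℂ)} (hU0 : ∀ ω, U 0 ω = z)
    (hU : (latticeLangevinDynamics (fundamentalLatticeRep 2) β').IsSolution (fundamentalRep (Fin 2)) hW.natFiltration P W U)
    (t₀ u : ℝ≥0)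
    (ht₀ : Real.log (96 * |β'| * (Fintype.card (Edge 3 L) : ℝ) + 10 * |β'| * (Fintype.card (Plaquette 3 L) : ℝ) + Real.log 2 +
      (Fintype.card (Edge 3 L) : ℝ) * Real.log (3 / 2)) ≤ 2 * (1 - 12 * |β'|) * t₀)
    {T : ℝ} (hT : 0 < T) {r : ℝ} (hr : 0 < r) :
    P.real {ω | r ≤ |T⁻¹ * (∫ s in Ioc 0 T, wilsonAction (fundamentalRep (Fin 2)) (U (2 + t₀ + u + s.toNNReal) ω) /
          (Fintype.card (Plaquette 3 L) : ℝ)) -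
        ∫ V, wilsonAction (fundamentalRep (Fin 2)) V / (Fintype.card (Plaquette 3 L) : ℝ) ∂(wilsonMeasure (d := 3) (L := L) (fundamentalRep (Fin 2)) β')|} ≤
      2 * Real.exp 1 * Real.exp (-((1 - 12 * |β'|) * T * r ^ 2 /
        (128 / ((1 - 12 * |β'|) * (Fintype.card (Plaquette 3 L) : ℝ)) + 8 * r))) := by
  classical
  haveI := secondCountableTopology_su2
  haveI := borelSpace_config L
  haveI : IsProbabilityMeasure (wilsonMeasure (d := 3) (L := L) (fundamentalRep (Fin 2)) β') :=
    isProbabilityMeasure_wilsonMeasure (d := 3) (L := L) (fundamentalRep (Fin 2)) (continuous_fundamentalRep (Fin 2)) β'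
  have hlam : 0 < 1 - 12 * |β'| := by linarith
  have hP : 0 < (Fintype.card (Plaquette 3 L) : ℝ) := card_plaquette_three_pos L
  -- the observable `s̄ = S_W/#𝒫 ∈ [0, 4]`, continuous, variance `≤ 32/(λ#𝒫)`
  set G : GaugeConfig 3 L (Matrix.specialUnitaryGroup (Fin 2) ℂ) → ℝ := fun V =>
    wilsonAction (fundamentalRep (Fin 2)) V / (Fintype.card (Plaquette 3 L) : ℝ) with hGdef
  have hGc : Continuous G := continuous_wilsonAction_su2.div_const _
  have hG0 : ∀ V, 0 ≤ G V := fun V => div_nonneg (wilsonAction_su2_nonneg V) hP.le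
  have hG4 : ∀ V, G V ≤ 4 := fun V => by
    rw [hGdef]; dsimp only; rw [div_le_iff₀ hP]; exact wilsonAction_su2_le V
  set m : ℝ := ∫ V, G V ∂(wilsonMeasure (d := 3) (L := L) (fundamentalRep (Fin 2)) β') with hm
  have hm0 : 0 ≤ m := integral_nonneg hG0
  have hm4 : m ≤ 4 := by
    have := integral_mono (integrable_of_continuous_of_compactSpace hGc (wilsonMeasure (d := 3) (L := L) (fundamentalRep (Fin 2)) β'))
      (integrable_const (μ := (wilsonMeasure (d := 3) (L := L) (fundamentalRep (Fin 2)) β')) (4 : ℝ)) hG4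
    rwa [integral_const, probReal_univ, one_smul] at this
  have hGb : ∀ V, |G V - m| ≤ 4 := fun V => abs_le.2 ⟨by linarith [hG0 V], by linarith [hG4 V]⟩
  set σ : ℝ := Real.sqrt (32 / ((1 - 12 * |β'|) * (Fintype.card (Plaquette 3 L) : ℝ))) with hσdef
  have hσpos : 0 < σ := Real.sqrt_pos.2 (by positivity)
  have hσ2 : ∫ V, (G V - ∫ V', G V' ∂(wilsonMeasure (d := 3) (L := L) (fundamentalRep (Fin 2)) β')) ^ 2 ∂(wilsonMeasure (d := 3) (L := L) (fundamentalRep (Fin 2)) β') ≤ σ ^ 2 := by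
    rw [hσdef, Real.sq_sqrt (by positivity)]
    exact wilson_actionDensity_variance_uniform L β' hβ
  -- upper and lower tails
  have hplus := coldStart_timeAverage_tail_le_bernstein_uniform L β' hβ z hW hU0 hU hGc (by norm_num) hGb hσpos hσ2 t₀ u ht₀ hT hr
  have hnegm : ∫ V, -G V ∂(wilsonMeasure (d := 3) (L := L) (fundamentalRep (Fin 2)) β') = -m := by rw [integral_neg, hm]
  have hGb' : ∀ V, |(-G V) - ∫ V', -G V' ∂(wilsonMeasure (d := 3) (L := L) (fundamentalRep (Fin 2)) β')| ≤ 4 := fun V => by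
    rw [hnegm, show -G V - -m = -(G V - m) by ring, abs_neg]; exact hGb V
  have hσ2' : ∫ V, ((-G V) - ∫ V', -G V' ∂(wilsonMeasure (d := 3) (L := L) (fundamentalRep (Fin 2)) β')) ^ 2 ∂(wilsonMeasure (d := 3) (L := L) (fundamentalRep (Fin 2)) β') ≤ σ ^ 2 := by
    rw [hnegm]
    have e : (fun V => ((-G V) - -m) ^ 2) = fun V => (G V - m) ^ 2 := funext fun V => by ring
    rw [e, hm]; exact hσ2
  have hminus := coldStart_timeAverage_tail_le_bernstein_uniform L β' hβ z hW hU0 hU (G := fun V => -G V) hGc.neg (by norm_num) hGb'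
    hσpos hσ2' t₀ u ht₀ hT hr
  simp only [integral_neg] at hminus
  rw [← hm] at hminus
  have hrate : Real.exp 1 * Real.exp (-((1 - 12 * |β'|) * T * r ^ 2 / (4 * σ ^ 2 + 2 * 4 * r))) =
      Real.exp 1 * Real.exp (-((1 - 12 * |β'|) * T * r ^ 2 / (128 / ((1 - 12 * |β'|) * (Fintype.card (Plaquette 3 L) : ℝ)) + 8 * r))) := by
    rw [hσdef, Real.sq_sqrt (by positivity)]
    congr 2; ring
  rw [hrate] at hplus hminus
  have hsub : {ω | r ≤ |T⁻¹ * (∫ s in Ioc 0 T, G (U (2 + t₀ + u + s.toNNReal) ω)) - m|} ⊆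
      {ω | r ≤ T⁻¹ * (∫ s in Ioc 0 T, G (U (2 + t₀ + u + s.toNNReal) ω)) - m} ∪
        {ω | r ≤ T⁻¹ * (-(∫ s in Ioc 0 T, G (U (2 + t₀ + u + s.toNNReal) ω))) - -m} := by
    intro ω hω
    simp only [Set.mem_setOf_eq, Set.mem_union] at hω ⊢
    rcases le_abs'.1 hω with h | h
    · right; linarith
    · left; exact h
  calc P.real {ω | r ≤ |T⁻¹ * (∫ s in Ioc 0 T, G (U (2 + t₀ + u + s.toNNReal) ω)) - m|}
      ≤ P.real ({ω | r ≤ T⁻¹ * (∫ s in Ioc 0 T, G (U (2 + t₀ + u + s.toNNReal) ω)) - m} ∪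
          {ω | r ≤ T⁻¹ * (-(∫ s in Ioc 0 T, G (U (2 + t₀ + u + s.toNNReal) ω))) - -m}) := measureReal_mono hsub
    _ ≤ P.real {ω | r ≤ T⁻¹ * (∫ s in Ioc 0 T, G (U (2 + t₀ + u + s.toNNReal) ω)) - m} +
          P.real {ω | r ≤ T⁻¹ * (-(∫ s in Ioc 0 T, G (U (2 + t₀ + u + s.toNNReal) ω))) - -m} := measureReal_union_le _ _
    _ ≤ Real.exp 1 * Real.exp (-((1 - 12 * |β'|) * T * r ^ 2 / (128 / ((1 - 12 * |β'|) * (Fintype.card (Plaquette 3 L) : ℝ)) + 8 * r))) +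
          Real.exp 1 * Real.exp (-((1 - 12 * |β'|) * T * r ^ 2 / (128 / ((1 - 12 * |β'|) * (Fintype.card (Plaquette 3 L) : ℝ)) + 8 * r))) :=
        add_le_add hplus hminus
    _ = _ := by ring

end Summit.QuantumFields.YangMills.Theorems.ColdStartUniversality

end
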